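import Summits.BirchSwinnertonDyer.BirchSwinnertonDyer.Theorems.MordellShaFreeCutOfHeegnerNonTorsion
import Summits.BirchSwinnertonDyer.Rank1Residual.Partition.AnticyclotomicControlPublishedPlaces
import Summits.BirchSwinnertonDyer.Rank1Residual.Partition.MainConjecturesAnticyclotomicGood
import Literature.NumberTheory.EllipticCurves.AnticyclotomicPConverseLinks

set_option linter.dupNamespace false
set_option autoImplicit false

/-! # Route `MordellShaFreeCut` (rung S2b) — crux `AnalyticRankOneOfRankOneFiniteShaThree`
(stmt-BirchSwinnertonDyer-19160): the `ℚ`-level Heegner-point research stub of the v2 cut SPLIT into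
its algebraic link (anticyclotomic control at the additive prime `3`) and its analytic link (main
conjecture ∘ `3`-adic Waldspurger/BDP formula at the trivial character), EVERY SYMBOL A TREE OBJECT

Cell `bsd-cn100`, typer seat `bsd-cn100-ty` g2; the `p = 3` twin of
`CongruentShaFreeCutTwoAdicLinks.lean` (read that module docstring for the design: why no `3`-adic
`L`-function is posited, and why the links are stated in the non-vanishing currency; the generic,
curve- and prime-independent half — predicate `AcPConverseLinks.CharValueEqLogSqAt`, step (4)
`AcPConverseLinks.not_isOfFinAddOrder_of_links`, the descent lemma — is
`Literature/NumberTheory/EllipticCurves/AnticyclotomicPConverseLinks.lean`). Supports, does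
not close, stmt-BirchSwinnertonDyer-19160. HONEST FRAMING: nothing here proves crux B, the leaf
`rankOne_threeConverse_mordellCurve` or any case of BSD; two OPEN statements are NAMED
(`@[conjecture] def`, nothing asserted) and their composition to the v2 research stub — the
hypothesis `hNT` of the landed
`MordellShaFreeCutOfHeegnerNonTorsion.analyticRankOne_of_facts_of_heegnerNonTorsion`, carried here
VERBATIM as the conclusion of `heegnerNonTorsionAtThree_of_threeAdicLinks` — is PROVED.

SETTING. `W/ℚ` globally minimal elliptic with `j(W) = 0` (every Mordell curve `y² = x³ + D` is
`ℚ`-isomorphic to such a `W`, `stub_minimalModelReduction`; these are the CM curves by `ℤ[ζ₃]`, and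
`3`, ramified in `ℚ(√−3)`, divides `N(W)` with exponent `≥ 2`: the reduction at `3` is ADDITIVE for
every such `W`), an auxiliary imaginary quadratic `K` with the Heegner hypothesis for `N = N(W)` and
`3 = v v̄` split, `ι : K ↪ ℚ₃` inducing `v`, the anticyclotomic `ℤ₃`-extension `κ` with topological
generator `γ`, `𝔛 = AcSelmer.XAc (W_K) 3 κ v̄ ∅ γ` (relaxed at `v`, strict at `v̄`; reduction-type
independent local conditions), `F` a generator of `char_Λ 𝔛`, `Λ = ℤ₃⟦T⟧`.

* `ThreeAdicControlOfRankOne` (algebraic; CGLS 2022 Thm. 5.1.1 / JSW 2017 Thm. 3.3.1 / Castella 2018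
  Thm. 2.3 shape): `rank W(K) = 1 ∧ #Ш(W/K)[3^∞] < ∞ ⟹ 𝔛` torsion and `F(0) ≠ 0`, in the tree's
  currency `∃ m, AcSelmer.XAc.HasCharValuationAt … m` (reused, not restated). Not carried from
  the template: the exact valuation of `F(0)` and CGLS's `E(ℚ_p)[p] = 0` (which fails for `y² = x³ +
  D` at `3` whenever `D` is a `3`-adic square: `(0, ±√D)` are `3`-torsion).
* `ThreeAdicCharValueEqHeegnerLogSq` (analytic; CGLS display (5.4) ∘ Thm. 5.1.3 shape, BDP 2013
  Thm. 5.13, Castella 2018 Thm. 3.2): under (Sel) `corank_{ℤ₃} Sel_{3^∞}(W/K) = 1`, `𝔛` torsion and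
  `F(0) = u · (log_W(z(m₀ • P_ι))/m₀)²` with `u ∈ ℚ₃`, `u ≠ 0`, for every Heegner point `P` of level
  `N` — the Literature predicate `AcPConverseLinks.CharValueEqLogSqAt W 3 κ v̄ γ ι P`. `-- TODO(constant):` printed good-reduction constant `ℤ_p^× · c_E⁻²(1 − a_p p⁻¹ + p⁻¹)²`; none
  in print at additive `3`. The `3`-adic `L`-function of a proof lives inside this link (Fan–Wan v2
  Thm. 5.18 + 4.2/4.4 over `ℚ(√−3)`, unrefereed; Kříž v5).
* GLUE (proved): `heegnerNonTorsionAtThree_of_threeAdicLinks` (Kato on the twist ⟹ the rank-one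
  data over `K`; the anticyclotomic datum exists; two generators of one principal ideal; a torsion
  point has zero formal logarithm) and `cruxB_of_threeAdicLinks`.

PLACEMENT: both links are theorems in print at good ordinary `p > 2` (CGLS, BCS 2025, BDP) and at
`p ∥ N` (Castella 2018), for CM curves at good ordinary `p` (Burungale–Tian 2020); neither is in
print at an additive prime. References: [CastellaGrossiLeeSkinner2022] Thm. 4.2.2, 5.1.1, 5.1.3,
(5.4); [Castella2018] Def. 2.2, Thm. 2.3, 3.2; [JetchevSkinnerWan2017] Thm. 3.3.1;
[BertoliniDarmonPrasanna2013] Thm. 5.13; [FanWan2023] Thm. 4.2/4.4, 5.18, 6.9 (claims);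
[SilvermanAEC2009] IV.6.4, VII.2.2. -/

noncomputable section

open scoped Classical

namespace Summit.BirchSwinnertonDyer.BirchSwinnertonDyer.Theorems.MordellShaFreeCutThreeAdicLinks

open WeierstrassCurve NumberField IsDedekindDomain Field Literature.NumberTheory.EllipticCurves
  Literature.NumberTheory.EllipticCurves.Castella2018
open Summit.BirchSwinnertonDyer.BirchSwinnertonDyer.Theses.MordellShaFreeCut
open Summit.BirchSwinnertonDyer.BirchSwinnertonDyer.Theorems.MordellShaFreeCutOfHeegnerNonTorsion
  (analyticRankOne_of_facts_of_heegnerNonTorsion)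
/-! ## 1. The two links (OPEN; named, nothing asserted) -/

/-- **Link A (algebraic) — anticyclotomic control at the ADDITIVE prime `3` of the `j = 0` curves, in
the non-vanishing currency.** For `W/ℚ` globally minimal elliptic with `j(W) = 0`, an imaginary
quadratic `K` with the Heegner hypothesis for `N = N(W)` and `3 = v v̄` split, `ι : K ↪ ℚ₃` inducing
`v`, the anticyclotomic `ℤ₃`-extension `κ` with topological generator `γ`: if `rank_ℤ W(K) = 1` and
`#Ш(W/K)[3^∞] < ∞`, then `𝔛 = X_ac(W[3^∞])` over `K_∞` (relaxed at `v`, strict at `v̄`;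
`AcSelmer.XAc`) is `Λ`-torsion and a generator `F` of its characteristic ideal has `F(0) ≠ 0` — in
the tree's currency `AcSelmer.XAc.HasCharValuationAt … m` for SOME `m` (not prescribed). SHAPE
of CGLS 2022 Thm. 5.1.1 (`thm511_anticyclotomicControl`, good ordinary `p > 2`, with the exact
valuation and the hypothesis `E(ℚ_p)[p] = 0`, neither carried here), JSW 2017 Thm. 3.3.1, Castella
2018 Thm. 2.3; OPEN at the additive prime `3`. Research-grade; nothing asserted; strictly weaker than
crux B. [cite: CastellaGrossiLeeSkinner2022, Thm. 5.1.1 (shape only; nothing asserted)]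
[cite: JetchevSkinnerWan2017, Thm. 3.3.1 (shape only; nothing asserted)]
[cite: Castella2018, Def. 2.2 and Thm. 2.3 (arXiv:1704.06608 p. 5) (shape only; nothing asserted)] -/
@[conjecture] def ThreeAdicControlOfRankOne : Prop :=
  ∀ (W : WeierstrassCurve ℚ) [W.IsElliptic] [W.IsGloballyMinimal], W.j = 0 →
    ∀ (K : Type) [Field K] [NumberField K] (N : ℕ) [NeZero N],
    W.conductorNorm ℤ = N → IsImaginaryQuadratic K →
      SatisfiesHeegnerHypothesis N K → SatisfiesHeegnerHypothesis 3 K →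
    ∀ (ι : K →+* ℚ_[3]) (v vbar : HeightOneSpectrum (𝓞 K)),
      (∀ x : 𝓞 K, x ∈ v.asIdeal ↔ ‖ι (x : K)‖ < 1) →
      ((3 : ℕ) : 𝓞 K) ∈ vbar.asIdeal → vbar ≠ v →
    ∀ (κ : ZpExtension K 3), κ.IsAnticyclotomic →
    ∀ (γ : absoluteGaloisGroup K) [Fact (κ.IsTopGenerator γ)],
      (W.baseChange K).mordellWeilRank = 1 →
      Finite (AddCommGroup.primaryComponent (W.baseChange K).sha 3) →
      ∃ m : ℕ, AcSelmer.XAc.HasCharValuationAt (W.baseChange K) 3 κ vbar ∅ γ m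

/-- **Link B (analytic) — the `3`-adic anticyclotomic main conjecture for the `j = 0` curves at the
trivial character, composed with the `3`-adic Waldspurger/BDP formula: `F(0) = u · log_ω(P_K)²`,
`u ≠ 0`.** For `W`, `K`, `N`, `ι`, `v`, `v̄`, `κ`, `γ` as in Link A, under (Sel)
`corank_{ℤ₃} Sel_{3^∞}(W/K) = 1`, and every Heegner point `P ∈ W(K)` of level `N` (`IsHeegnerPoint`):
`𝔛` is `Λ`-torsion and a generator `F` of `char_Λ 𝔛` satisfies `F(0) = u · (log_W(z(m₀ • P_ι))/m₀)²`
for some NON-ZERO `u ∈ ℚ₃` (`padicPointOf`, `formalIndex`, `padicLogPoint`; the Literature predicate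
`AcPConverseLinks.CharValueEqLogSqAt` at `(W, 3, κ, v̄, γ, ι, P)`). SHAPE of CGLS 2022
display (5.4) ∘ Thm. 5.1.3 (`display54_thm513_generator_constantCoeff`, good Eisenstein `p > 2`, with
`u ∈ ℤ_p^× · c_E⁻²(1 − a_p p⁻¹ + p⁻¹)²`), BDP 2013 Thm. 5.13, Castella 2018 Thm. 3.2; the `3`-adic
`L`-function is eliminated by the composition. OPEN at the additive prime `3` (Fan–Wan v2 Thm. 5.18
with 4.2/4.4 over `ℚ(√−3)`, unrefereed; Kříž v5 §§9–10). Research-grade; nothing asserted.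
-- TODO(constant): the printed good-reduction constant; at additive `3` none is in print, only `u ≠ 0`.
[cite: CastellaGrossiLeeSkinner2022, Thm. 4.2.2, Thm. 5.1.3 and display (5.4) (shape only; nothing asserted)]
[cite: BertoliniDarmonPrasanna2013, Thm. 5.13 (shape only; nothing asserted)]
[cite: Castella2018, Thm. 3.2 (arXiv:1704.06608 p. 9) (shape only; nothing asserted)] -/
@[conjecture] def ThreeAdicCharValueEqHeegnerLogSq : Prop :=
  ∀ (W : WeierstrassCurve ℚ) [W.IsElliptic] [W.IsGloballyMinimal], W.j = 0 →
    ∀ (K : Type) [Field K] [NumberField K] (N : ℕ) [NeZero N],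
    W.conductorNorm ℤ = N → IsImaginaryQuadratic K →
      SatisfiesHeegnerHypothesis N K → SatisfiesHeegnerHypothesis 3 K →
    ∀ (ι : K →+* ℚ_[3]) (v vbar : HeightOneSpectrum (𝓞 K)),
      (∀ x : 𝓞 K, x ∈ v.asIdeal ↔ ‖ι (x : K)‖ < 1) →
      ((3 : ℕ) : 𝓞 K) ∈ vbar.asIdeal → vbar ≠ v →
    ∀ (κ : ZpExtension K 3), κ.IsAnticyclotomic →
    ∀ (γ : absoluteGaloisGroup K) [Fact (κ.IsTopGenerator γ)],
      (W.baseChange K).selmerCorank 3 = 1 →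
    ∀ (P : (W.baseChange K).toAffine.Point), IsHeegnerPoint N W K P →
      AcPConverseLinks.CharValueEqLogSqAt W 3 κ vbar γ ι P

/-! ## 2. The composition (PROVED) -/

/-- **The v2 research stub of S2b from the two `3`-adic links** (granted Kato's finiteness theorem
for the twist, `hKato`): for `W/ℚ` globally minimal elliptic with `j = 0`, `K` imaginary quadratic with
the Heegner hypothesis for `N = N(W)` and for `3`, `L(W^{(d_K)}, 1) ≠ 0`, `rank W(ℚ) = 1`,
`#Ш(W/ℚ)[3^∞] < ∞`, every Heegner point `P ∈ W(K)` of level `N` has infinite order. The conclusion is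
the hypothesis `hNT` of `MordellShaFreeCutOfHeegnerNonTorsion.analyticRankOne_of_facts_of_heegnerNonTorsion`
token for token. Proof as for `CongruentShaFreeCutTwoAdicLinks.heegnerNonTorsionAtTwo_of_twoAdicLinks`.
[cite: CastellaGrossiLeeSkinner2022, §5.2 (proof of Thm. 5.2.1: the shape of a BDP-type p-converse)]
[cite: SilvermanAEC2009, IV.6.4 and VII.2.2] -/
theorem heegnerNonTorsionAtThree_of_threeAdicLinks
    (hKato : ∀ (W : WeierstrassCurve ℚ) [W.IsElliptic] (p : ℕ) [Fact p.Prime],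
      kato_finite_of_L_one_ne_zero W p)
    (hA : ThreeAdicControlOfRankOne) (hB : ThreeAdicCharValueEqHeegnerLogSq) :
    ∀ (W : WeierstrassCurve ℚ) [W.IsElliptic] [W.IsGloballyMinimal], W.j = 0 →
      ∀ (K : Type) [Field K] [NumberField K] (N : ℕ) [NeZero N], W.conductorNorm ℤ = N →
        IsImaginaryQuadratic K → SatisfiesHeegnerHypothesis N K → SatisfiesHeegnerHypothesis 3 K →
          (W.quadraticTwist (NumberField.discr K : ℚ)).entireLFunction 1 ≠ 0 →
            W.mordellWeilRank = 1 → Finite (AddCommGroup.primaryComponent W.sha 3) →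
              ∀ (P : (W.baseChange K).toAffine.Point), IsHeegnerPoint N W K P →
                ¬ IsOfFinAddOrder P := by
  intro W _ _ hj K _ _ N _ hN hK hHN hH3 hL hrank hsha P hP hPtor
  -- the rank-one data over `K`
  obtain ⟨hrk, hcork, hshaK⟩ :=
    AcPConverseLinks.rank_corank_sha_baseChange_of_twist_L_one_ne_zero hKato W 3 hK hL hrank hsha
  -- the anticyclotomic datum
  obtain ⟨κ, γ, 𝔭, hκ, hγ, h𝔭, he, hf⟩ :=
    Summit.BirchSwinnertonDyer.Rank1Residual.X11b.exists_anticyclotomic_generator_degreeOnePrime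
      3 K hK hH3
  haveI : Fact (κ.IsTopGenerator γ) := ⟨hγ⟩
  let ι : K →+* ℚ_[3] := Summit.BirchSwinnertonDyer.Rank1Residual.X11b.embAt K 3 𝔭 h𝔭 he hf
  obtain ⟨vbar, hvbar, hne⟩ :=
    Summit.BirchSwinnertonDyer.Rank1Residual.X11b.exists_other_prime hH3
      (Summit.BirchSwinnertonDyer.Rank1Residual.X11b.inducedPlace ι)
      (Summit.BirchSwinnertonDyer.Rank1Residual.X11b.natCast_mem_inducedPlace ι)
  have hv := Summit.BirchSwinnertonDyer.Rank1Residual.X11b.mem_inducedPlace_iff ι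
  -- step (4): the two links at this datum force `P` to be non-torsion
  exact AcPConverseLinks.not_isOfFinAddOrder_of_links W 3 κ vbar γ ι P
    (hA W hj K N hN hK hHN hH3 ι (Summit.BirchSwinnertonDyer.Rank1Residual.X11b.inducedPlace ι) vbar
      hv hvbar hne κ hκ γ hrk hshaK)
    (hB W hj K N hN hK hHN hH3 ι (Summit.BirchSwinnertonDyer.Rank1Residual.X11b.inducedPlace ι) vbar
      hv hvbar hne κ hκ γ hcork P hP) hPtor

/-- **Crux B of S2b from the two `3`-adic links and eight refereed facts** (`3`-parity, Modularity,
Hoffstein–Luo, Kato, existence of Heegner points, Gross–Zagier + Kolyvagin): by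
`heegnerNonTorsionAtThree_of_threeAdicLinks` and the landed v2 composition
`MordellShaFreeCutOfHeegnerNonTorsion.analyticRankOne_of_facts_of_heegnerNonTorsion`. CONDITIONAL on
the two open links; credits nothing. [cite: GrossZagier1986, Thm. I.6.3 with V.§2]
[cite: CastellaGrossiLeeSkinner2022, §5.2 (proof of Thm. 5.2.1)] -/
theorem cruxB_of_threeAdicLinks
    (hpar : ∀ (W : WeierstrassCurve ℚ) [W.IsElliptic] (p : ℕ) [Fact p.Prime], p_parity W p)
    (hmod : ModularForms.exists_isNewformOf) (hHL : HoffsteinLuo1997_exists_twist_L_one_ne_zero)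
    (hKato : ∀ (W : WeierstrassCurve ℚ) [W.IsElliptic] (p : ℕ) [Fact p.Prime],
      kato_finite_of_L_one_ne_zero W p)
    (hHP : ∀ (W : WeierstrassCurve ℚ) (K : Type) [Field K] [NumberField K],
      exists_isHeegnerPoint W K)
    (hGZ : ∀ (W : WeierstrassCurve ℚ) (N : ℕ) [NeZero N] (K : Type) [Field K] [NumberField K],
      analyticRankEK_eq_one_iff_heegner_nonTorsion W N K)
    (hA : ThreeAdicControlOfRankOne) (hB : ThreeAdicCharValueEqHeegnerLogSq) :
    Summit.BirchSwinnertonDyer.BirchSwinnertonDyer.Theses.MordellShaFreeCut.AnalyticRankOneOfRankOneFiniteShaThree :=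
  analyticRankOne_of_facts_of_heegnerNonTorsion hpar hmod hHL hKato hHP hGZ
    (heegnerNonTorsionAtThree_of_threeAdicLinks hKato hA hB)

end Summit.BirchSwinnertonDyer.BirchSwinnertonDyer.Theorems.MordellShaFreeCutThreeAdicLinks

end
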